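import Literature.NumberTheory.EllipticCurves.PastenValuationProductThm115Proofs
import Literature.NumberTheory.EllipticCurves.PastenCor162FromThm161Proofs
import HarnessLib

/-!
# Pasten's Theorem 1.15 from Theorem 16.1 alone (proofs)

Topic `NumberTheory/EllipticCurves`; namespace `Literature.NumberTheory.EllipticCurves`.
A *proofs* sibling (theorems only: no definition, no named fact, no instance) of
`Literature.NumberTheory.EllipticCurves.PastenValuationProduct`, for its named fact
`pasten_thm_1_15` (H. Pasten, *Shimura curves and the abc conjecture*, J. Number Theory 254 (2024)
214–335 = arXiv:1705.09251, Theorem 1.15, arXiv p. 8: `Tam(E) < K_{S,ε} · N_E^{11/2+ε}` for every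
`E/ℚ` semi-stable away from `S` with at least two primes of multiplicative reduction).

The printed proof of Theorem 1.15 is the chain
Theorem 16.1 ⟹ Corollary 16.2 ⟹ Corollary 16.3 ⟹ Theorem 1.15 (arXiv pp. 49–50, plus the
absorption of the finitely many exceptional curves into `K_{S,ε}`). Both links are already proved
in the tree, in two sibling files with disjoint concerns:

* `pasten_cor_16_2_of_thm_16_1` (`PastenCor162FromThm161Proofs`): Corollary 16.2 (tree fact
  `pasten_cor_16_2`) from Theorem 16.1 taken as an explicit hypothesis (the `(n-1)`-st-root trick
  over the admissible `D = N_E^*` or `D = N_E^*/p_i`);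
* `pasten_thm_1_15_of_cor_16_2` (`PastenValuationProductThm115Proofs`): Theorem 1.15 from
  Corollary 16.2 (Kodaira–Néron `c_p ≤ 4` resp. `c_p = v_p(Δ_E)`, `4^{ω(N)} ≪_δ N^δ`, Shafarevich
  finiteness below the threshold `N₀(S, ε)`, isomorphism invariance of `Tam`).

This file only composes them, so that the residual content of the named fact `pasten_thm_1_15`
is recorded in ONE kernel-checked statement: `pasten_thm_1_15` follows from Pasten's Theorem 16.1
and nothing else. Theorem 16.1 itself ("for all but finitely many `E/ℚ` semi-stable away from
`S`: for every admissible factorisation `N_E = DM`, `∏_{p ∣ D} v_p(Δ_E) < N_E^{11/3+ε}`"; its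
proof uses the Shimura-curve parametrisations `X_0^D(M) → A_{D,M}` given by Jacquet–Langlands and
modularity, the Ribet–Takahashi comparison of modular degrees, Frey's formula with the Faltings
height, Petersson-norm bounds for newforms, the Arakelov-type integrality bound on `X_0^D(M)` and
the Manin-constant bound) is NOT vendored as a named fact anywhere in the tree; here, as in the
two siblings, it is the explicit hypothesis `h161`, spelled exactly as there (semi-stable away from
`S` as `p² ∤ N_E` for primes `p ∉ S`; "all but finitely many" as a conductor threshold `N₁(S, ε)`;
admissible `D`: `D ∣ N_E`, `gcd(D, N_E/D) = 1`, `D` squarefree with an even number of prime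
factors, supported away from `S`).

## Main statement

* `pasten_thm_1_15_of_thm_16_1 (h161 : «Theorem 16.1») : pasten_thm_1_15`.

Once Theorem 16.1 is available as a theorem `T`, the discharge of the named fact is the one-liner
`theorem pasten_thm_1_15_holds : pasten_thm_1_15 := pasten_thm_1_15_of_thm_16_1 T`.

## References

* [PastenShimura2024] H. Pasten, *Shimura curves and the abc conjecture*, J. Number Theory 254
  (2024) 214–335, doi:10.1016/j.jnt.2023.07.002, arXiv:1705.09251 — Thm 1.15 (p. 8), Thm 16.1,
  Cor 16.2, Cor 16.3 (pp. 49–50, arXiv numbering).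
-/

noncomputable section

namespace Literature.NumberTheory.EllipticCurves

/-- **[PastenShimura2024, Theorem 1.15] from [PastenShimura2024, Theorem 16.1] alone.**
With Theorem 16.1 as the explicit hypothesis `h161` (verbatim the hypothesis of
`pasten_cor_16_2_of_thm_16_1`: for every finite set of primes `S` and `ε > 0` there is `N₁` such
that for every elliptic `W/ℚ` with `p² ∤ N_W` for all primes `p ∉ S` and `N_W ≥ N₁`, and every
`D ∣ N_W` with `gcd(D, N_W/D) = 1`, `D` squarefree with an even number of prime factors, all
outside `S`, one has `∏_{p ∣ D} v_p(|Δ_min(W)|) < N_W^{11/3+ε}`), the named fact `pasten_thm_1_15`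
(`Tam(E) < K_{S,ε} · N_E^{11/2+ε}` for `E/ℚ` semi-stable away from `S` with two distinct places of
multiplicative reduction) holds. Proof: the printed chain Thm 16.1 ⟹ Cor 16.2
(`pasten_cor_16_2_of_thm_16_1`) ⟹ Cor 16.3 / Thm 1.15 (`pasten_thm_1_15_of_cor_16_2`).
[cite: PastenShimura2024, Theorem 1.15; Theorem 16.1, Corollary 16.2, Corollary 16.3 (arXiv pp. 8, 49–50)] -/
theorem pasten_thm_1_15_of_thm_16_1
    (h161 : ∀ (S : Finset ℕ) (ε : ℝ), 0 < ε → ∃ N₁ : ℕ, ∀ (W : WeierstrassCurve ℚ) [W.IsElliptic],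
      (∀ p : ℕ, p.Prime → p ∉ S → ¬ p ^ 2 ∣ W.conductorNorm ℤ) → N₁ ≤ W.conductorNorm ℤ →
        ∀ D : ℕ, D ∣ W.conductorNorm ℤ → D.Coprime (W.conductorNorm ℤ / D) → Squarefree D →
          Even D.primeFactors.card → (∀ p ∈ D.primeFactors, p ∉ S) →
            ((∏ p ∈ D.primeFactors, (W.minimalDiscriminantNorm ℤ).factorization p : ℕ) : ℝ)
              < (W.conductorNorm ℤ : ℝ) ^ (11 / 3 + ε : ℝ)) :
    pasten_thm_1_15 :=
  pasten_thm_1_15_of_cor_16_2 (pasten_cor_16_2_of_thm_16_1 h161)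

/-- The same composition with the intermediate Corollary 16.2 exposed: Theorem 16.1 gives both the
tree fact `pasten_cor_16_2` and, through it, `pasten_thm_1_15`.
[cite: PastenShimura2024, Theorem 16.1, Corollary 16.2, Theorem 1.15] -/
theorem pasten_cor_16_2_and_thm_1_15_of_thm_16_1
    (h161 : ∀ (S : Finset ℕ) (ε : ℝ), 0 < ε → ∃ N₁ : ℕ, ∀ (W : WeierstrassCurve ℚ) [W.IsElliptic],
      (∀ p : ℕ, p.Prime → p ∉ S → ¬ p ^ 2 ∣ W.conductorNorm ℤ) → N₁ ≤ W.conductorNorm ℤ →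
        ∀ D : ℕ, D ∣ W.conductorNorm ℤ → D.Coprime (W.conductorNorm ℤ / D) → Squarefree D →
          Even D.primeFactors.card → (∀ p ∈ D.primeFactors, p ∉ S) →
            ((∏ p ∈ D.primeFactors, (W.minimalDiscriminantNorm ℤ).factorization p : ℕ) : ℝ)
              < (W.conductorNorm ℤ : ℝ) ^ (11 / 3 + ε : ℝ)) :
    pasten_cor_16_2 ∧ pasten_thm_1_15 :=
  ⟨pasten_cor_16_2_of_thm_16_1 h161, pasten_thm_1_15_of_thm_16_1 h161⟩

end Literature.NumberTheory.EllipticCurves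

end
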